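import Summits.NavierStokesRegularity.FluidComputer.LambWork
import Summits.NavierStokesRegularity.FluidComputer.LambGridBessel

/-!
# The certified Lamb-efficiency column and the clock corollary — part C `LambCertified`
(pub-fluidc cell, rung R2, CARD O7 §5)

HONEST FRAMING (cell `pub-fluidc`, verbatim): *low prior, high value-of-information experiment on
Tao's machine paradigm; NOT a claim that NS blows up.*

Mathematics and Lean by seat idea-2 gen 6 (`HOME/pub-fluidc-idea-2/SKETCH-R2-lamb-galerkin.lean`, sha16
97789fb5c3bf72e2, 659 lines, CARD O7 §5); split into three tree files (≤ 400 lines each, one namespace,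
declaration names unchanged) and landed by seat p2 gen 2: `LambWork` (§§0–3: flux is Lamb work,
Cauchy–Schwarz efficiency ≤ 1, Frisch (2.48) with Lamb work), `LambGridBessel` (§4a: grid characters,
Bessel, Parseval — independent of `LambWork`), `LambCertified` (§4b–§5: Hermitian Lagrange identity, the
certified column `abs_shellTransfer_le_certified`, the clock corollary; imports both).

§4 closes the remaining step to the certified column of PREREG-NEG-R2-G6 §1 ON THE GRID, where the
engines measure: with Orszag-exact dealiasing (`Dealiasing.psLamb_eq_rotational`, cubic mask, `3K < N`)
the out-band Lamb energy is a sum of squared grid-transform coefficients of the pointwise product over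
modes distinct mod `N`, so grid Bessel (`grid_bessel`), the Hermitian Lagrange identity in `ℂ³`
(`lagrange_ccross`) and grid Parseval for `ω` / `u` (`sum_sqNorm_gridVort`, `sum_sqNorm_gridVel`) give
**`abs_shellTransfer_le_certified`**: `|Π| ≤ √(2E_O) · min(√Mu √(2Z_B), √Mw √(2E_B))` for ANY grid bounds
`Mu ≥ ‖u(n)‖²`, `Mw ≥ ‖ω(n)‖²` — i.e. `e_L ≤ 1` exactly with the engines' grid maxima (dns-A diag `umax` =
max‖u‖, `wmax` = max‖ω‖). §5 is the clock corollary **`outBandAmplitude_linear_growth`**: along a Galerkin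
truncation unforced in the out-band, `√(2E_O(T)) ≤ √(2E_O(0)) + T · √Mu · √(2 Zmax)` (ODE comparison
`sqrt_linear_of_deriv_le`). 0 sorry; Mathlib + the tree's `RotationalForm` / `ScaleByScaleBudget` only.
Helper definitions: `gridVel`, `gridVort` (grid synthesis of the truncated velocity / vorticity).
-/


noncomputable section

open Complex ComplexConjugate Finset
open scoped BigOperators
open Literature.Analysis.FluidPDE.FluidComputer
open Literature.Analysis.FluidPDE.FluidComputer.ShellTransfer

namespace Summit.NavierStokesRegularity.FluidComputer.LambCeiling.Galerkin

variable (U : FourierVelocity)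

/-! ## 4. On the grid: Bessel for the dealiased pseudo-spectral Lamb vector, and the certified column

The engines' `umax`, `wmax` are GRID maxima. With `Dealiasing` (Orszag exactness, `psLamb_eq_rotational`)
the out-band Lamb energy `L_O` is a sum of squared GRID-transform coefficients of the pointwise product
`u × ω` on the `N³` grid, over modes that are distinct modulo `N`; Bessel's inequality for the grid
characters, the Hermitian Lagrange identity `‖a × b‖² + |Σ aᵢ conj bᵢ|² = ‖a‖² ‖b‖²` in `ℂ³`, and grid
Parseval for `ω` (resp. `u`) then give `L_O ≤ (max_grid |u|²) · 2Z` and `L_O ≤ (max_grid |ω|²) · 2E` —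
so the certified column `e_L ≤ 1` of PREREG-NEG-R2-G6 §1 holds EXACTLY for the engines' arithmetic with
their grid maxima (no `grid sup ≤ true sup` caveat), up to time stepping and round-off. -/

section Grid

open Literature.Analysis.FluidPDE.FluidComputer.ShellTransfer.Dealiasing AddChar ZMod

variable {N : ℕ} [NeZero N]
/-- **Hermitian Lagrange identity** in `ℂ³` for the bilinear cross product:
`‖a × b‖² + |Σᵢ aᵢ conj bᵢ|² = ‖a‖² ‖b‖²`. [folklore] -/
theorem lagrange_ccross (a b : Fin 3 → ℂ) :
    sqNorm (ccross a b) + ‖∑ i, a i * conj (b i)‖ ^ 2 = sqNorm a * sqNorm b := by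
  unfold sqNorm
  simp only [Fin.sum_univ_three, ccross, Matrix.cons_val_zero, Matrix.cons_val_one, Matrix.cons_val_two,
    Matrix.head_cons, Matrix.tail_cons, Complex.sq_norm, Complex.normSq_apply, Complex.mul_re,
    Complex.mul_im, Complex.sub_re, Complex.sub_im, Complex.add_re, Complex.add_im, Complex.conj_re,
    Complex.conj_im]
  ring

/-- Hence `‖a × b‖² ≤ ‖a‖² ‖b‖²` in `ℂ³`. [folklore] -/
theorem sqNorm_ccross_le (a b : Fin 3 → ℂ) : sqNorm (ccross a b) ≤ sqNorm a * sqNorm b := by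
  have h := lagrange_ccross a b
  nlinarith [sq_nonneg ‖∑ i, a i * conj (b i)‖]

/-- The grid velocity and vorticity of a coefficient field synthesised from the mode set `B`. -/
def gridVel (N : ℕ) [NeZero N] (B : Finset (Fin 3 → ℤ)) (n : Fin 3 → ZMod N) : Fin 3 → ℂ :=
  fun a => synth B (fun p => U.coeff p a) n

/-- The grid vorticity `ω(n)`. -/
def gridVort (N : ℕ) [NeZero N] (B : Finset (Fin 3 → ℤ)) (n : Fin 3 → ZMod N) : Fin 3 → ℂ :=
  fun b => synth B (fun p => (curl U).coeff p b) n

/-- `Σ_n ‖ω(n)‖² = N³ · 2 Z_B` (grid Parseval + `truncEnergy_curl`). -/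
theorem sum_sqNorm_gridVort {K : ℕ} (hK : 2 * K < N) {B : Finset (Fin 3 → ℤ)} (hB : B ⊆ Dealiasing.box K) :
    ∑ n : Fin 3 → ZMod N, sqNorm (gridVort U N B n) = (N : ℝ) ^ 3 * (2 * truncEnstrophy U B) := by
  unfold sqNorm gridVort
  rw [Finset.sum_comm]
  simp_rw [grid_parseval hK hB]
  rw [← Finset.mul_sum, ← truncEnergy_curl U B]
  congr 1
  unfold truncEnergy
  rw [Finset.mul_sum, Finset.sum_comm]
  refine Finset.sum_congr rfl fun k _ => ?_
  rw [← sqNorm_coeff]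
  rfl

/-- `Σ_n ‖u(n)‖² = N³ · 2 E_B`. -/
theorem sum_sqNorm_gridVel {K : ℕ} (hK : 2 * K < N) {B : Finset (Fin 3 → ℤ)} (hB : B ⊆ Dealiasing.box K) :
    ∑ n : Fin 3 → ZMod N, sqNorm (gridVel U N B n) = (N : ℝ) ^ 3 * (2 * truncEnergy U B) := by
  unfold sqNorm gridVel
  rw [Finset.sum_comm]
  simp_rw [grid_parseval hK hB]
  rw [← Finset.mul_sum]
  congr 1
  unfold truncEnergy
  rw [Finset.mul_sum, Finset.sum_comm]
  refine Finset.sum_congr rfl fun k _ => ?_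
  rw [← sqNorm_coeff]
  rfl

/-- **The out-band Lamb energy is bounded by the grid data**: for `û` supported in `B ⊆ {|k_i| ≤ K}`,
`3K < N`, `O ⊆ B`, and `M` any bound on the grid values `‖u(n)‖²`:
`L_O = Σ_{k∈O} ‖(u×ω)^_B(k)‖² ≤ M · 2 Z_B`. -/
theorem sqNormOn_rotational_le_gridSup_mul_enstrophy {K : ℕ} (hK : 3 * K < N) {B O : Finset (Fin 3 → ℤ)}
    (hB : B ⊆ Dealiasing.box K) (hO : O ⊆ B) (hU : ∀ p ∉ B, U.coeff p = 0) {M : ℝ}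
    (hM : ∀ n : Fin 3 → ZMod N, sqNorm (gridVel U N B n) ≤ M) :
    sqNormOn (rotational U B) O ≤ M * (2 * truncEnstrophy U B) := by
  have hK2 : 2 * K < N := by omega
  have hNpos : (0 : ℝ) < (N : ℝ) ^ 3 := by
    have : (0 : ℝ) < N := by exact_mod_cast Nat.pos_of_ne_zero (NeZero.ne N)
    positivity
  -- Orszag: rotational = psLamb on O; Bessel per component
  have hinj : ∀ k ∈ O, ∀ l ∈ O, modN N k = modN N l → k = l := fun k hk l hl h =>
    modN_inj_of_box hK2 (hB (hO hk)) (hB (hO hl)) h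
  have h1 : (N : ℝ) ^ 3 * sqNormOn (rotational U B) O ≤
      ∑ n : Fin 3 → ZMod N, sqNorm (ccross (gridVel U N B n) (gridVort U N B n)) := by
    unfold sqNormOn sqNorm
    rw [Finset.sum_comm, Finset.mul_sum]
    rw [show (∑ n : Fin 3 → ZMod N, ∑ j : Fin 3, ‖ccross (gridVel U N B n) (gridVort U N B n) j‖ ^ 2) =
        ∑ j : Fin 3, ∑ n : Fin 3 → ZMod N, ‖ccross (gridVel U N B n) (gridVort U N B n) j‖ ^ 2 from
      Finset.sum_comm]
    refine Finset.sum_le_sum fun j _ => ?_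
    have hb := grid_bessel (fun n => ccross (gridVel U N B n) (gridVort U N B n) j) O hinj
    refine le_trans (le_of_eq ?_) hb
    congr 1
    refine Finset.sum_congr rfl fun k hk => ?_
    rw [← psLamb_eq_rotational hK hB U hU (hB (hO hk)) j]
    rfl
  -- pointwise Lagrange and the grid bound
  have h2 : ∑ n : Fin 3 → ZMod N, sqNorm (ccross (gridVel U N B n) (gridVort U N B n)) ≤
      M * ∑ n : Fin 3 → ZMod N, sqNorm (gridVort U N B n) := by
    rw [Finset.mul_sum]
    refine Finset.sum_le_sum fun n _ => ?_
    exact (sqNorm_ccross_le _ _).trans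
      (mul_le_mul_of_nonneg_right (hM n) (sqNorm_nonneg _))
  rw [sum_sqNorm_gridVort U hK2 hB] at h2
  have h3 : (N : ℝ) ^ 3 * sqNormOn (rotational U B) O ≤ (N : ℝ) ^ 3 * (M * (2 * truncEnstrophy U B)) := by
    calc (N : ℝ) ^ 3 * sqNormOn (rotational U B) O ≤ _ := h1
      _ ≤ M * ((N : ℝ) ^ 3 * (2 * truncEnstrophy U B)) := h2
      _ = (N : ℝ) ^ 3 * (M * (2 * truncEnstrophy U B)) := by ring
  exact le_of_mul_le_mul_left h3 hNpos

/-- The same with the roles of `u` and `ω` exchanged: `L_O ≤ (max_grid ‖ω‖²) · 2 E_B`. -/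
theorem sqNormOn_rotational_le_gridSupVort_mul_energy {K : ℕ} (hK : 3 * K < N) {B O : Finset (Fin 3 → ℤ)}
    (hB : B ⊆ Dealiasing.box K) (hO : O ⊆ B) (hU : ∀ p ∉ B, U.coeff p = 0) {M : ℝ}
    (hM : ∀ n : Fin 3 → ZMod N, sqNorm (gridVort U N B n) ≤ M) :
    sqNormOn (rotational U B) O ≤ M * (2 * truncEnergy U B) := by
  have hK2 : 2 * K < N := by omega
  have hNpos : (0 : ℝ) < (N : ℝ) ^ 3 := by
    have : (0 : ℝ) < N := by exact_mod_cast Nat.pos_of_ne_zero (NeZero.ne N)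
    positivity
  have hinj : ∀ k ∈ O, ∀ l ∈ O, modN N k = modN N l → k = l := fun k hk l hl h =>
    modN_inj_of_box hK2 (hB (hO hk)) (hB (hO hl)) h
  have h1 : (N : ℝ) ^ 3 * sqNormOn (rotational U B) O ≤
      ∑ n : Fin 3 → ZMod N, sqNorm (ccross (gridVel U N B n) (gridVort U N B n)) := by
    unfold sqNormOn sqNorm
    rw [Finset.sum_comm, Finset.mul_sum]
    rw [show (∑ n : Fin 3 → ZMod N, ∑ j : Fin 3, ‖ccross (gridVel U N B n) (gridVort U N B n) j‖ ^ 2) =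
        ∑ j : Fin 3, ∑ n : Fin 3 → ZMod N, ‖ccross (gridVel U N B n) (gridVort U N B n) j‖ ^ 2 from
      Finset.sum_comm]
    refine Finset.sum_le_sum fun j _ => ?_
    have hb := grid_bessel (fun n => ccross (gridVel U N B n) (gridVort U N B n) j) O hinj
    refine le_trans (le_of_eq ?_) hb
    congr 1
    refine Finset.sum_congr rfl fun k hk => ?_
    rw [← psLamb_eq_rotational hK hB U hU (hB (hO hk)) j]
    rfl
  have h2 : ∑ n : Fin 3 → ZMod N, sqNorm (ccross (gridVel U N B n) (gridVort U N B n)) ≤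
      M * ∑ n : Fin 3 → ZMod N, sqNorm (gridVel U N B n) := by
    rw [Finset.mul_sum]
    refine Finset.sum_le_sum fun n _ => ?_
    calc sqNorm (ccross (gridVel U N B n) (gridVort U N B n))
        ≤ sqNorm (gridVel U N B n) * sqNorm (gridVort U N B n) := sqNorm_ccross_le _ _
      _ ≤ sqNorm (gridVel U N B n) * M := mul_le_mul_of_nonneg_left (hM n) (sqNorm_nonneg _)
      _ = M * sqNorm (gridVel U N B n) := mul_comm _ _
  rw [sum_sqNorm_gridVel U hK2 hB] at h2
  have h3 : (N : ℝ) ^ 3 * sqNormOn (rotational U B) O ≤ (N : ℝ) ^ 3 * (M * (2 * truncEnergy U B)) := by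
    calc (N : ℝ) ^ 3 * sqNormOn (rotational U B) O ≤ _ := h1
      _ ≤ M * ((N : ℝ) ^ 3 * (2 * truncEnergy U B)) := h2
      _ = (N : ℝ) ^ 3 * (M * (2 * truncEnergy U B)) := by ring
  exact le_of_mul_le_mul_left h3 hNpos

/-- **THE CERTIFIED COLUMN, EXACTLY.** For a coefficient field supported in a dealiased cubic mask
`B = I ∪ O ⊆ {|k_i| ≤ K}`, `3K < N`, with GRID maxima `‖u(n)‖² ≤ Mu`, `‖ω(n)‖² ≤ Mw` on the `N³` grid:
`|Π| ≤ √(2E_O) · min( √Mu · √(2Z_B), √Mw · √(2E_B) )` — i.e. `e_L ≤ 1` with the engines' `umax`, `wmax`. -/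
theorem abs_shellTransfer_le_certified {K : ℕ} (hK : 3 * K < N) {I O : Finset (Fin 3 → ℤ)}
    (h : Disjoint I O) (hB : I ∪ O ⊆ Dealiasing.box K) (hU : ∀ p ∉ I ∪ O, U.coeff p = 0) {Mu Mw : ℝ}
    (hMu : ∀ n : Fin 3 → ZMod N, sqNorm (gridVel U N (I ∪ O) n) ≤ Mu)
    (hMw : ∀ n : Fin 3 → ZMod N, sqNorm (gridVort U N (I ∪ O) n) ≤ Mw) :
    |shellTransfer U O I| ≤ Real.sqrt (2 * truncEnergy U O) *
      min (Real.sqrt Mu * Real.sqrt (2 * truncEnstrophy U (I ∪ O)))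
          (Real.sqrt Mw * Real.sqrt (2 * truncEnergy U (I ∪ O))) := by
  have hO : O ⊆ I ∪ O := Finset.subset_union_right
  have h0 := abs_shellTransfer_le_lamb U I O h hU
  have hL1 := sqNormOn_rotational_le_gridSup_mul_enstrophy U hK hB hO hU hMu
  have hL2 := sqNormOn_rotational_le_gridSupVort_mul_energy U hK hB hO hU hMw
  have hs1 : Real.sqrt (sqNormOn (rotational U (I ∪ O)) O) ≤
      Real.sqrt Mu * Real.sqrt (2 * truncEnstrophy U (I ∪ O)) := by
    rw [← Real.sqrt_mul' Mu (mul_nonneg (by norm_num) (truncEnstrophy_nonneg U (I ∪ O)))]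
    exact Real.sqrt_le_sqrt hL1
  have hs2 : Real.sqrt (sqNormOn (rotational U (I ∪ O)) O) ≤
      Real.sqrt Mw * Real.sqrt (2 * truncEnergy U (I ∪ O)) := by
    have hE : (0:ℝ) ≤ 2 * truncEnergy U (I ∪ O) :=
      mul_nonneg (by norm_num) (Finset.sum_nonneg fun k _ => modalEnergy_nonneg U k)
    rw [← Real.sqrt_mul' Mw hE]
    exact Real.sqrt_le_sqrt hL2
  exact h0.trans (mul_le_mul_of_nonneg_left (le_min hs1 hs2) (Real.sqrt_nonneg _))

end Grid


/-! ## 5. The clock corollary: the out-band amplitude grows at most linearly at the certified rate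

PREREG-NEG-R2-G6 §1 reads a level step in cascade currency: `U_out(t) − U_out(0) ≤ ∫₀ᵗ e_L · D`,
`D = min(umax √(2Z), wmax √(2E))`, so a bounded efficiency only rescales the clock. Here is the `e_L ≤ 1`
instance as a theorem over the tree's Galerkin objects: along an (out-band-unforced) Galerkin truncation
on a dealiased mask, `√(2E_O(T)) ≤ √(2E_O(0)) + T · √Mu · √(2 Zmax)` for any grid bound `Mu ≥ ‖u(n,t)‖²`
and enstrophy bound `Zmax ≥ Z_B(t)` on `[0, T]`. -/

section Clock

variable {N : ℕ} [NeZero N]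

/-- ODE comparison behind the clock: if `E ≥ 0` is differentiable on `[0,T]` with
`E' ≤ √(2E) · D`, `D ≥ 0`, then `√(2E(T)) ≤ √(2E(0)) + T · D` (regularise `√(2E + δ²)`, mean value
inequality, `δ → 0`). [standard textbook material] -/
theorem sqrt_linear_of_deriv_le {E : ℝ → ℝ} {D T : ℝ} (hT : 0 ≤ T) (hD : 0 ≤ D) (hE0 : ∀ t, 0 ≤ E t)
    (hE : ∀ t ∈ Set.Icc (0:ℝ) T, ∃ E', HasDerivAt E E' t ∧ E' ≤ Real.sqrt (2 * E t) * D) :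
    Real.sqrt (2 * E T) ≤ Real.sqrt (2 * E 0) + T * D := by
  refine le_of_forall_pos_le_add fun δ hδ => ?_
  have hpos : ∀ t, 0 < 2 * E t + δ ^ 2 := fun t => by have := hE0 t; positivity
  have key : ∀ t ∈ Set.Icc (0:ℝ) T,
      ∃ g', HasDerivAt (fun s => Real.sqrt (2 * E s + δ ^ 2)) g' t ∧ g' ≤ D := by
    intro t ht
    obtain ⟨E', hE', hle⟩ := hE t ht
    have h2 : HasDerivAt (fun s => 2 * E s + δ ^ 2) (2 * E') t := (hE'.const_mul 2).add_const (δ ^ 2)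
    refine ⟨_, h2.sqrt (hpos t).ne', ?_⟩
    have hs : 0 < Real.sqrt (2 * E t + δ ^ 2) := Real.sqrt_pos.2 (hpos t)
    have hmono : Real.sqrt (2 * E t) ≤ Real.sqrt (2 * E t + δ ^ 2) :=
      Real.sqrt_le_sqrt (by nlinarith)
    have hm := mul_le_mul_of_nonneg_right hmono hD
    rw [div_le_iff₀ (by positivity)]
    linarith
  have hcont : ContinuousOn (fun s => Real.sqrt (2 * E s + δ ^ 2)) (Set.Icc 0 T) := by
    intro t ht
    obtain ⟨g', hg', _⟩ := key t ht
    exact hg'.continuousAt.continuousWithinAt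
  have hdiff : DifferentiableOn ℝ (fun s => Real.sqrt (2 * E s + δ ^ 2)) (interior (Set.Icc 0 T)) := by
    intro t ht
    rw [interior_Icc] at ht
    obtain ⟨g', hg', _⟩ := key t (Set.Ioo_subset_Icc_self ht)
    exact hg'.differentiableAt.differentiableWithinAt
  have hle : ∀ t ∈ interior (Set.Icc (0:ℝ) T), deriv (fun s => Real.sqrt (2 * E s + δ ^ 2)) t ≤ D := by
    intro t ht
    rw [interior_Icc] at ht
    obtain ⟨g', hg', hb⟩ := key t (Set.Ioo_subset_Icc_self ht)
    rw [hg'.deriv]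
    exact hb
  have hmv := (convex_Icc (0:ℝ) T).image_sub_le_mul_sub_of_deriv_le hcont hdiff hle 0
    (Set.left_mem_Icc.2 hT) T (Set.right_mem_Icc.2 hT) hT
  have h1 : Real.sqrt (2 * E T) ≤ Real.sqrt (2 * E T + δ ^ 2) := Real.sqrt_le_sqrt (by nlinarith)
  have h2 : Real.sqrt (2 * E 0 + δ ^ 2) ≤ Real.sqrt (2 * E 0) + δ := by
    rw [Real.sqrt_le_left (by positivity)]
    have hsq := Real.sq_sqrt (show (0:ℝ) ≤ 2 * E 0 by have := hE0 0; positivity)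
    nlinarith [Real.sqrt_nonneg (2 * E 0), mul_nonneg hδ.le (Real.sqrt_nonneg (2 * E 0))]
  simp only [sub_zero] at hmv
  linarith

/-- **Clock corollary (certified).** Along a Galerkin truncation on the dealiased mask
`B = I ∪ O ⊆ {|k_i| ≤ K}`, `3K < N`, `ν ≥ 0`, unforced in the out-band: if on `[0, T]` the GRID velocity
obeys `‖u(n,t)‖² ≤ Mu` and `Z_B(t) ≤ Zmax`, then `√(2E_O(T)) ≤ √(2E_O(0)) + T · √Mu · √(2 Zmax)` —
the out-band amplitude gain of a level step is bounded by its CLOCK (R2 dictionary, PREREG-NEG-R2-G6 §1,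
with the Lamb efficiency replaced by its certified ceiling 1). -/
theorem outBandAmplitude_linear_growth {K : ℕ} (hK : 3 * K < N) {I O : Finset (Fin 3 → ℤ)}
    (h : Disjoint I O) (hB : I ∪ O ⊆ Dealiasing.box K) {Uc : ℝ → FourierVelocity} {ν : ℝ} (hν : 0 ≤ ν)
    {c : ℝ → (Fin 3 → ℤ) → ℂ} {f : ℝ → (Fin 3 → ℤ) → Fin 3 → ℂ}
    (hG : IsGalerkinSolution Uc (I ∪ O) ν c f) (hsupp : ∀ t, ∀ p ∉ I ∪ O, (Uc t).coeff p = 0)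
    (hf : ∀ t, injectionRate (Uc t) (f t) O = 0) {T Mu Zmax : ℝ} (hT : 0 ≤ T)
    (hMu : ∀ t ∈ Set.Icc (0:ℝ) T, ∀ n : Fin 3 → ZMod N, sqNorm (gridVel (Uc t) N (I ∪ O) n) ≤ Mu)
    (hZ : ∀ t ∈ Set.Icc (0:ℝ) T, truncEnstrophy (Uc t) (I ∪ O) ≤ Zmax) :
    Real.sqrt (2 * truncEnergy (Uc T) O) ≤
      Real.sqrt (2 * truncEnergy (Uc 0) O) + T * (Real.sqrt Mu * Real.sqrt (2 * Zmax)) := by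
  have hE0 : ∀ t, 0 ≤ truncEnergy (Uc t) O := fun t => by
    unfold truncEnergy
    exact Finset.sum_nonneg fun k _ => modalEnergy_nonneg _ _
  refine sqrt_linear_of_deriv_le (E := fun t => truncEnergy (Uc t) O) hT
    (mul_nonneg (Real.sqrt_nonneg _) (Real.sqrt_nonneg _)) hE0 ?_
  intro t ht
  obtain ⟨E', hE', hle⟩ := outsideEnergy_deriv_le h hν hG t (hsupp t) (hf t)
  refine ⟨E', hE', hle.trans (mul_le_mul_of_nonneg_left ?_ (Real.sqrt_nonneg _))⟩
  have hL := sqNormOn_rotational_le_gridSup_mul_enstrophy (Uc t) hK hB Finset.subset_union_right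
    (hsupp t) (hMu t ht)
  calc Real.sqrt (sqNormOn (rotational (Uc t) (I ∪ O)) O)
      ≤ Real.sqrt (Mu * (2 * truncEnstrophy (Uc t) (I ∪ O))) := Real.sqrt_le_sqrt hL
    _ = Real.sqrt Mu * Real.sqrt (2 * truncEnstrophy (Uc t) (I ∪ O)) :=
        Real.sqrt_mul' Mu (mul_nonneg (by norm_num) (truncEnstrophy_nonneg _ _))
    _ ≤ Real.sqrt Mu * Real.sqrt (2 * Zmax) :=
        mul_le_mul_of_nonneg_left (Real.sqrt_le_sqrt (by linarith [hZ t ht])) (Real.sqrt_nonneg _)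

end Clock

end Summit.NavierStokesRegularity.FluidComputer.LambCeiling.Galerkin

end
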